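import Literature.AnabelianGeometry.Anabelioids.ComponentsTransitive
import Literature.AnabelianGeometry.Anabelioids.FreeFibres
import Literature.AnabelianGeometry.SemiGraphs.SurfaceTypeFreeCuspQuotients
import Literature.AnabelianGeometry.SemiGraphs.SurfaceTypeQuasiCoherent
import Literature.AnabelianGeometry.SemiGraphs.SubCoverticialOfObject
import Literature.AnabelianGeometry.SemiGraphs.SurfaceTypeCoverings
import Literature.GroupTheory.TopologicallyCyclicIndex
import Mathlib.Algebra.Group.Action.Sigma
import HarnessLib

/-!
# [SemiAnbd] Example 2.10 (3): surface type ⇒ totally sub-coverticial — the covering object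

Mochizuki, *Semi-graphs of anabelioids*, Publ. RIMS **42** (2006), Ex. 2.10 p. 31: a semi-graph of
anabelioids of surface type (pointed stable curve) is "totally universally sub-coverticial" — print:
"one verifies immediately … from the well-known structure of fundamental groups of hyperbolic Riemann
surfaces of finite type". [cite: MochizukiSemiAnbd2006, Ex. 2.10 p.31]

PROOF-ONLY (cell abc-iut, layer L3, row G31 (3), seat abc-iut-w5-d195; plan of abc-iut-L3-t4 gen 3,
`SurfaceTypeFreeCuspQuotients.lean` docstring; no definition).  For `𝒢` of surface type over `Σ` and a
prime `ℓ ∈ Σ` we BUILD an object `A = {S_v, T_e, ψ_b}` of `B(𝒢)` ([SemiAnbd] Def. 2.2 (i)) with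

* `S_v` := the object of `𝒢_v` with fibre `Π_v / H̃_v` for the open subgroup `H̃_v` of index `ℓ²` of
  `IsOfSurfaceType.exists_open_subgroup_cusps_free` (abc-iut-L3-t4), on whose cosets every branch group
  `Π_b` acts with all orbits of size `ℓ` — so `S_v` has ONE component (`exists_obj_fibre_quotient`);
* `T_e` := the object of `𝒢_e` with fibre `ℓ` copies of `Π_e / U_e`, `U_e` the (unique!) open subgroup
  of index `ℓ` of `Π_e` — so `T_e` has at least two components whenever some branch of `e` abuts;
* `ψ_b : b^* S_v ⥲ T_e`: both fibres are `Π_e`-sets all of whose stabilisers are open of index `ℓ`;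
  since `Π_e ↪ Π_v` is a closed embedding onto the closure of a cusp inertia group (surface type:
  `branchHom_continuous_injective`, abc-iut-L3-t4), `Π_e` is topologically cyclic, so all these
  stabilisers COINCIDE (`Subgroup.eq_of_isOpen_of_index_eq_of_dense_zpowers`) and the two `Π_e`-sets of
  cardinality `ℓ²` are isomorphic (`MulAction.exists_equivariant_equiv_of_stabilizer_eq`,
  `nonempty_iso_of_equivariant_equiv`).

Main results: `IsOfSurfaceType.exists_bObj_connected_split` (the object) and
`IsOfSurfaceType.isSubCoverticial` (every closed edge of a surface-type `𝒢` is sub-coverticial, by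
`BObj.isSubCoverticial_of_components`).  The universal statement (conjunct (3) itself) follows with the
stability of surface type under finite étale coverings (`SurfaceTypeSubCoverticial.lean`).
-/

namespace Literature.AnabelianGeometry.SemiGraphs

open CategoryTheory CategoryTheory.PreGaloisCategory
open Literature.AnabelianGeometry.Anabelioids Literature.GroupTheory.CombinatorialGroupTheory
open scoped Pointwise

universe v₁ u₁ u

namespace SemiGraphOfAnabelioids

variable {𝒢 : SemiGraphOfAnabelioids.{v₁, u₁, u}} {Sigma : Set ℕ}

/-! ### The `Π_e`-set of a pulled-back vertex object -/

section Branch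

variable {v : 𝒢.graph.Vertex} (F : 𝒢.V v ⥤ FintypeCat.{v₁})
  {b : 𝒢.graph.Branch} (h : 𝒢.graph.abuts b = some v)
  (Fe : 𝒢.E (𝒢.graph.edgeOf b) ⥤ FintypeCat.{v₁})
  (α : (𝒢.pull b v h).pullback ⋙ Fe ≅ F) (S : 𝒢.V v)

/-- **The action upstairs is the branch homomorphism's action downstairs**: along
`α : b^* ⋙ Fe ≅ F`, `σ ∈ Π_e = Aut Fe` acts on the fibre of `b^* S` as `ψ_α(σ) ∈ Π_v` acts on `F(S)`,
`ψ_α = (α-conjugation) ∘ π₁(b^*)`. [cite: MochizukiSemiAnbd2006, Def. 2.1 p.23] -/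
theorem hom_app_smul (σ : Aut Fe) (y : Fe.obj ((𝒢.pull b v h).pullback.obj S)) :
    α.hom.app S (σ • y) =
      ((Aut.autMulEquivOfIso α).toMonoidHom.comp (pi1Map (𝒢.pull b v h).pullback Fe) σ) •
        α.hom.app S y := by
  rw [mulAction_def, mulAction_def]
  change α.hom.app S (σ.hom.app _ y) =
    (α.inv.app S ≫ σ.hom.app ((𝒢.pull b v h).pullback.obj S) ≫ α.hom.app S) (α.hom.app S y)
  rw [FintypeCat.comp_apply, FintypeCat.comp_apply, ← FintypeCat.comp_apply (α.hom.app S) (α.inv.app S),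
    Iso.hom_inv_id_app]
  rfl

/-- **Stabilisers upstairs are pulled back from downstairs.** [cite: MochizukiSemiAnbd2006, Def. 2.1 p.23] -/
theorem stabilizer_eq_comap (y : Fe.obj ((𝒢.pull b v h).pullback.obj S)) :
    MulAction.stabilizer (Aut Fe) y =
      (MulAction.stabilizer (Aut F) (α.hom.app S y)).comap
        ((Aut.autMulEquivOfIso α).toMonoidHom.comp (pi1Map (𝒢.pull b v h).pullback Fe)) := by
  ext σ
  rw [Subgroup.mem_comap, MulAction.mem_stabilizer_iff, MulAction.mem_stabilizer_iff, ← hom_app_smul]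
  constructor
  · intro hσ; rw [hσ]
  · intro hσ
    have hinj : Function.Injective (α.hom.app S) := fun a a' haa => by
      have := congrArg (α.inv.app S) haa
      rwa [← FintypeCat.comp_apply, ← FintypeCat.comp_apply, Iso.hom_inv_id_app] at this
    exact hinj hσ

end Branch

/-! ### Topological cyclicity of the edge groups of a surface-type `𝒢` -/

/-- **`Π_e` is topologically cyclic** for `𝒢` of surface type: for a branch `b` of `e` abutting to `v`,
`Π_e ↪ Π_v` is a closed embedding onto the closure of a cusp inertia group `ι(⟨c_j⟩)`, so the powers of
the pull-back of `ι(c_j)` are dense in `Π_e`. [cite: MochizukiSemiAnbd2006, Ex. 2.10 p.31] -/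
theorem IsOfSurfaceType.exists_dense_zpowers_piE (hS : 𝒢.IsOfSurfaceType Sigma) {v : 𝒢.graph.Vertex}
    {b : 𝒢.graph.Branch} (h : 𝒢.graph.abuts b = some v)
    (Fe : 𝒢.E (𝒢.graph.edgeOf b) ⥤ FintypeCat.{v₁}) [FiberFunctor Fe] :
    ∃ d : Aut Fe, Dense ((Subgroup.zpowers d : Subgroup (Aut Fe)) : Set (Aut Fe)) := by
  let F := GaloisCategory.getFiberFunctor (𝒢.V v)
  obtain ⟨g, r, ι, -, -, js, -, hbr⟩ := hS.vertex v F
  obtain ⟨α, hα⟩ := hbr ⟨b, h⟩ Fe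
  set ρ : Aut Fe →* Aut F :=
    (Aut.autMulEquivOfIso α).toMonoidHom.comp (pi1Map (𝒢.pull b v h).pullback Fe) with hρ
  obtain ⟨hcont, hinj⟩ := branchHom_continuous_injective hS.isOfInjectiveType F b h Fe α
  have hrange : (ρ.range : Set (Aut F)) =
      closure (ι '' ((PuncturedSurfaceGroup.cuspInertia (g := g) (js ⟨b, h⟩) :
        Subgroup (PuncturedSurfaceGroup g r)) : Set (PuncturedSurfaceGroup g r))) := hα
  set c : PuncturedSurfaceGroup g r := PuncturedSurfaceGroup.c (js ⟨b, h⟩) with hc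
  have himage : ι '' ((PuncturedSurfaceGroup.cuspInertia (g := g) (js ⟨b, h⟩) :
      Subgroup (PuncturedSurfaceGroup g r)) : Set (PuncturedSurfaceGroup g r)) =
      ((Subgroup.zpowers (ι c) : Subgroup (Aut F)) : Set (Aut F)) := by
    rw [PuncturedSurfaceGroup.cuspInertia, ← Subgroup.coe_map, MonoidHom.map_zpowers]
  -- a preimage `d` of `ι c`
  have hιc : ι c ∈ ρ.range := by
    rw [← SetLike.mem_coe, hrange, himage]
    exact subset_closure (Subgroup.mem_zpowers _)
  obtain ⟨d, hd⟩ := hιc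
  refine ⟨d, ?_⟩
  have hind : _root_.Topology.IsInducing ρ := (hcont.isClosedEmbedding hinj).isInducing
  rw [hind.dense_iff]
  intro x
  have himg : (ρ : Aut Fe → Aut F) '' ((Subgroup.zpowers d : Subgroup (Aut Fe)) : Set (Aut Fe)) =
      ((Subgroup.zpowers (ι c) : Subgroup (Aut F)) : Set (Aut F)) := by
    rw [← Subgroup.coe_map, MonoidHom.map_zpowers, hd]
  rw [himg, ← himage, ← hrange]
  exact ⟨x, rfl⟩

/-! ### Small group-theoretic bookkeeping -/

/-- Conjugate subgroups have the same index. [cite: MochizukiSemiAnbd2006, Rem. 2.2.1 p.24] -/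
theorem index_conjAct_smul {G : Type*} [Group G] (γ : G) (H : Subgroup G) :
    (ConjAct.toConjAct γ • H).index = H.index := by
  rw [Subgroup.pointwise_smul_def]
  exact Subgroup.index_map_of_bijective (MulAction.bijective _) _

/-- A conjugate of an open subgroup is open. [cite: MochizukiSemiAnbd2006, Rem. 2.2.1 p.24] -/
theorem isOpen_conjAct_smul {G : Type*} [Group G] [TopologicalSpace G] [IsTopologicalGroup G] (γ : G)
    {H : Subgroup G} (hH : IsOpen (H : Set G)) : IsOpen ((ConjAct.toConjAct γ • H : Subgroup G) : Set G) := by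
  have hset : ((ConjAct.toConjAct γ • H : Subgroup G) : Set G) = (fun x : G => γ⁻¹ * x * γ) ⁻¹' (H : Set G) := by
    ext x
    rw [SetLike.mem_coe, Subgroup.mem_pointwise_smul_iff_inv_smul_mem, ← _root_.map_inv,
      ConjAct.smul_def, ConjAct.ofConjAct_toConjAct, inv_inv, Set.mem_preimage, SetLike.mem_coe]
  rw [hset]
  exact hH.preimage ((continuous_const.mul continuous_id).mul continuous_const)

/-- In `ℓ` copies of a `G`-set, the stabiliser of `(i, q)` is the stabiliser of `q`. [folklore] -/
private theorem stabilizer_sigma_mk {G : Type*} [Group G] {ι : Type*} {X : Type*} [MulAction G X]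
    (i : ι) (q : X) :
    MulAction.stabilizer G (⟨i, q⟩ : Σ _ : ι, X) = MulAction.stabilizer G q := by
  ext g
  simp only [MulAction.mem_stabilizer_iff, Sigma.smul_mk, Sigma.mk.inj_iff, heq_eq_eq, true_and]

/-! ### The vertex objects -/

/-- **The vertex object `S_v`.**  For `𝒢` of surface type, a basepoint `F` of `𝒢_v` and a prime `ℓ ∈ Σ`:
an open subgroup `H̃ ≤ Π_v` of index `ℓ²` on whose coset space every branch group acts with all orbits
of size `ℓ` (`IsOfSurfaceType.exists_open_subgroup_cusps_free`, abc-iut-L3-t4), and an object `S_v`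
with fibre `Π_v/H̃` — one component, stabilisers the conjugates of `H̃`.
[cite: MochizukiSemiAnbd2006, Ex. 2.10 p.31] -/
theorem IsOfSurfaceType.exists_vertexObj (hS : 𝒢.IsOfSurfaceType Sigma) (v : 𝒢.graph.Vertex)
    (F : 𝒢.V v ⥤ FintypeCat.{v₁}) [FiberFunctor F] {ℓ : ℕ} (hℓ : ℓ.Prime) (hℓS : ℓ ∈ Sigma) :
    ∃ (Ht : Subgroup (Aut F)) (S : 𝒢.V v) (e : F.obj S ≃ Aut F ⧸ Ht),
      IsOpen (Ht : Set (Aut F)) ∧ Ht.index = ℓ ^ 2 ∧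
      (∀ (σ : Aut F) (x : F.obj S), e (σ • x) = σ • e x) ∧ Subsingleton (π₀Obj S) ∧
      (∀ x : F.obj S, ∃ γ : Aut F, e x = QuotientGroup.mk γ ∧
        MulAction.stabilizer (Aut F) x = ConjAct.toConjAct γ • Ht) ∧
      ∀ (b : {b : 𝒢.graph.Branch // 𝒢.graph.abuts b = some v})
        (Fe : 𝒢.E (𝒢.graph.edgeOf b.1) ⥤ FintypeCat.{v₁}) [FiberFunctor Fe],
        ∃ α : (𝒢.pull b.1 v b.2).pullback ⋙ Fe ≅ F, ∀ γ : Aut F,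
          ((ConjAct.toConjAct γ • Ht).subgroupOf (𝒢.branchSubgroup F b.1 b.2 Fe α)).index = ℓ := by
  obtain ⟨Ht, hHo, hHi, hcusp⟩ := hS.exists_open_subgroup_cusps_free v F hℓ hℓS
  obtain ⟨S, e, he, hπ, hstab⟩ := exists_obj_fibre_quotient F Ht hHo
  exact ⟨Ht, S, e, hHo, hHi, he, hπ, hstab, hcusp⟩

/-! ### The `Π_e`-set of `b^* S_v`: stabilisers open of index `ℓ`, cardinality `ℓ²` -/

section BranchFibre

variable {v : 𝒢.graph.Vertex} (F : 𝒢.V v ⥤ FintypeCat.{v₁})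
  {Ht : Subgroup (Aut F)} {S : 𝒢.V v} (e : F.obj S ≃ Aut F ⧸ Ht)
  (hstab : ∀ x : F.obj S, ∃ γ : Aut F, e x = QuotientGroup.mk γ ∧
    MulAction.stabilizer (Aut F) x = ConjAct.toConjAct γ • Ht)
  {b : 𝒢.graph.Branch} (h : 𝒢.graph.abuts b = some v)
  (Fe : 𝒢.E (𝒢.graph.edgeOf b) ⥤ FintypeCat.{v₁})
  (α : (𝒢.pull b v h).pullback ⋙ Fe ≅ F) {ℓ : ℕ}
  (hα : ∀ γ : Aut F, ((ConjAct.toConjAct γ • Ht).subgroupOf (𝒢.branchSubgroup F b h Fe α)).index = ℓ)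

include hstab hα in
/-- Every stabiliser of the `Π_e`-set `Fe(b^* S_v)` is open of index `ℓ`.
[cite: MochizukiSemiAnbd2006, Ex. 2.10 p.31] -/
theorem stabilizer_pullback_isOpen_index (y : Fe.obj ((𝒢.pull b v h).pullback.obj S)) :
    IsOpen (MulAction.stabilizer (Aut Fe) y : Set (Aut Fe)) ∧
      (MulAction.stabilizer (Aut Fe) y).index = ℓ := by
  refine ⟨stabilizer_isOpen (Aut Fe) y, ?_⟩
  obtain ⟨γ, -, hγ⟩ := hstab (α.hom.app S y)
  rw [stabilizer_eq_comap F h Fe α S y, hγ, Subgroup.index_comap]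
  exact hα γ

include α e in
/-- The `Π_e`-set `Fe(b^* S_v)` has `[Π_v : H̃]` points. [cite: MochizukiSemiAnbd2006, Ex. 2.10 p.31] -/
theorem card_pullback_eq_index :
    Nat.card (Fe.obj ((𝒢.pull b v h).pullback.obj S)) = Ht.index := by
  rw [Subgroup.index]
  exact Nat.card_congr ((FintypeCat.equivEquivIso.symm (α.app S)).trans e)

end BranchFibre

/-! ### The object of `B(𝒢)` -/

/-- **The covering object.**  For `𝒢` of surface type there is an object `A = {S_v, T_e, ψ_b}` of `B(𝒢)`
all of whose vertex constituents `S_v` have exactly ONE connected component and all of whose edge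
constituents `T_e` have at least TWO (hence, by `BObj.isSubCoverticial_of_components`, every closed edge
is sub-coverticial).  Construction: `S_v` with fibre `Π_v/H̃_v` (index `ℓ²`, branch orbits of size `ℓ`),
`T_e` with fibre `ℓ` copies of `Π_e/U_e` (`U_e` THE open subgroup of index `ℓ` of the topologically
cyclic group `Π_e`, when one exists), `ψ_b` from the equality of all stabilisers.
[cite: MochizukiSemiAnbd2006, Ex. 2.10 p.31] -/
theorem IsOfSurfaceType.exists_bObj_connected_split (hS : 𝒢.IsOfSurfaceType Sigma) :
    ∃ A : 𝒢.BObj, (∀ v, Subsingleton (π₀Obj (A.S v))) ∧ ∀ e, ∃ Q₁ Q₂ : π₀Obj (A.T e), Q₁ ≠ Q₂ := by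
  classical
  obtain ⟨⟨ℓ, hℓS⟩, hpr⟩ := hS.sigma_primes
  have hℓ : ℓ.Prime := hpr ℓ hℓS
  have hℓ2 : 2 ≤ ℓ := hℓ.two_le
  -- the vertex objects
  have hv := fun v : 𝒢.graph.Vertex =>
    hS.exists_vertexObj v (GaloisCategory.getFiberFunctor (𝒢.V v)) hℓ hℓS
  choose Ht Sv ev hHo hHi hev hπ₀ hstab hcusp using hv
  -- the edge objects: `ℓ` copies of `Π_e / U_e`
  let Ue : ∀ e : 𝒢.graph.Edge, Subgroup (Aut (GaloisCategory.getFiberFunctor (𝒢.E e))) := fun e =>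
    if hx : ∃ U : Subgroup (Aut (GaloisCategory.getFiberFunctor (𝒢.E e))),
        IsOpen (U : Set (Aut (GaloisCategory.getFiberFunctor (𝒢.E e)))) ∧ U.index = ℓ then
      Classical.choose hx else ⊤
  have hUo : ∀ e, IsOpen (Ue e : Set (Aut (GaloisCategory.getFiberFunctor (𝒢.E e)))) := by
    intro e
    by_cases hx : ∃ U : Subgroup (Aut (GaloisCategory.getFiberFunctor (𝒢.E e))),
        IsOpen (U : Set (Aut (GaloisCategory.getFiberFunctor (𝒢.E e)))) ∧ U.index = ℓ
    · simp only [Ue, dif_pos hx]; exact (Classical.choose_spec hx).1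
    · simp only [Ue, dif_neg hx]; exact isOpen_univ
  have hUspec : ∀ e, (∃ U : Subgroup (Aut (GaloisCategory.getFiberFunctor (𝒢.E e))),
      IsOpen (U : Set (Aut (GaloisCategory.getFiberFunctor (𝒢.E e)))) ∧ U.index = ℓ) →
      (Ue e).index = ℓ := by
    intro e hx
    simp only [Ue, dif_pos hx]; exact (Classical.choose_spec hx).2
  haveI : ∀ e : 𝒢.graph.Edge, Finite (Aut (GaloisCategory.getFiberFunctor (𝒢.E e)) ⧸ Ue e) :=
    fun e => Subgroup.quotient_finite_of_isOpen _ (hUo e)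
  have hT := fun e : 𝒢.graph.Edge =>
    exists_obj_fiber_equiv (GaloisCategory.getFiberFunctor (𝒢.E e))
      (Σ _ : Fin ℓ, Aut (GaloisCategory.getFiberFunctor (𝒢.E e)) ⧸ Ue e) (by
        rintro ⟨i, q⟩
        obtain ⟨γ, rfl⟩ := QuotientGroup.mk_surjective q
        rw [stabilizer_sigma_mk, stabilizer_quotient_mk]
        exact isOpen_conjAct_smul γ (hUo e))
  choose Te eT heT using hT
  -- stabilisers of the fibre of `T_e` are conjugates of `U_e`
  have hstabT : ∀ (e : 𝒢.graph.Edge) (z : (GaloisCategory.getFiberFunctor (𝒢.E e)).obj (Te e)),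
      ∃ γ : Aut (GaloisCategory.getFiberFunctor (𝒢.E e)),
        MulAction.stabilizer (Aut (GaloisCategory.getFiberFunctor (𝒢.E e))) z =
          ConjAct.toConjAct γ • Ue e := by
    intro e z
    obtain ⟨⟨i, q⟩, hq⟩ : ∃ p, eT e z = p := ⟨_, rfl⟩
    obtain ⟨γ, rfl⟩ := QuotientGroup.mk_surjective q
    refine ⟨γ, ?_⟩
    have hz : MulAction.stabilizer (Aut (GaloisCategory.getFiberFunctor (𝒢.E e))) z =
        MulAction.stabilizer (Aut (GaloisCategory.getFiberFunctor (𝒢.E e))) (eT e z) := by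
      ext σ
      rw [MulAction.mem_stabilizer_iff, MulAction.mem_stabilizer_iff, ← heT, (eT e).apply_eq_iff_eq]
    rw [hz, hq, stabilizer_sigma_mk, stabilizer_quotient_mk]
  -- the gluing isomorphisms
  have hψ : ∀ (b : 𝒢.graph.Branch) (v : 𝒢.graph.Vertex) (h : 𝒢.graph.abuts b = some v),
      Nonempty ((𝒢.pull b v h).pullback.obj (Sv v) ≅ Te (𝒢.graph.edgeOf b)) := by
    intro b v h
    set Fe := GaloisCategory.getFiberFunctor (𝒢.E (𝒢.graph.edgeOf b)) with hFe
    obtain ⟨α, hα⟩ := hcusp v ⟨b, h⟩ Fe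
    -- all stabilisers upstairs are open of index `ℓ`
    have hst := stabilizer_pullback_isOpen_index (GaloisCategory.getFiberFunctor (𝒢.V v)) (ev v)
      (hstab v) h Fe α hα
    have hcardP : Nat.card (Fe.obj ((𝒢.pull b v h).pullback.obj (Sv v))) = ℓ ^ 2 := by
      rw [card_pullback_eq_index (GaloisCategory.getFiberFunctor (𝒢.V v)) (ev v) h Fe α, hHi]
    -- a point upstairs
    obtain ⟨y₀⟩ : Nonempty (Fe.obj ((𝒢.pull b v h).pullback.obj (Sv v))) := by
      have : Nat.card (Fe.obj ((𝒢.pull b v h).pullback.obj (Sv v))) ≠ 0 := by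
        rw [hcardP]; exact pow_ne_zero 2 hℓ.ne_zero
      exact (Nat.card_ne_zero.mp this).1
    -- `U_e` is an open subgroup of index `ℓ`, and all open subgroups of index `ℓ` coincide
    have hx : ∃ U : Subgroup (Aut Fe), IsOpen (U : Set (Aut Fe)) ∧ U.index = ℓ := ⟨_, hst y₀⟩
    have hUi : (Ue (𝒢.graph.edgeOf b)).index = ℓ := hUspec _ hx
    obtain ⟨d, hd⟩ := hS.exists_dense_zpowers_piE h Fe
    have huniq : ∀ U : Subgroup (Aut Fe), IsOpen (U : Set (Aut Fe)) → U.index = ℓ →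
        U = Ue (𝒢.graph.edgeOf b) :=
      fun U hUo' hUi' => Literature.GroupTheory.Subgroup.eq_of_isOpen_of_index_eq_of_dense_zpowers hd
        hUo' (hUo _) (by rw [hUi']; exact hℓ.ne_zero) (by rw [hUi', hUi])
    -- the two `Π_e`-sets have the same constant stabiliser and the same cardinality
    have hX : ∀ y : Fe.obj ((𝒢.pull b v h).pullback.obj (Sv v)),
        MulAction.stabilizer (Aut Fe) y = Ue (𝒢.graph.edgeOf b) :=
      fun y => huniq _ (hst y).1 (hst y).2
    have hY : ∀ z : Fe.obj (Te (𝒢.graph.edgeOf b)),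
        MulAction.stabilizer (Aut Fe) z = Ue (𝒢.graph.edgeOf b) := by
      intro z
      obtain ⟨γ, hγ⟩ := hstabT (𝒢.graph.edgeOf b) z
      refine huniq _ ?_ ?_
      · rw [hγ]; exact isOpen_conjAct_smul γ (hUo _)
      · rw [hγ, index_conjAct_smul, hUi]
    have hcardT : Nat.card (Fe.obj (Te (𝒢.graph.edgeOf b))) = ℓ ^ 2 := by
      rw [Nat.card_congr (eT (𝒢.graph.edgeOf b)), Nat.card_sigma, Finset.sum_const, Finset.card_univ,
        Fintype.card_fin, smul_eq_mul, ← Subgroup.index, hUi, sq]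
    obtain ⟨f, hf⟩ := Literature.GroupTheory.MulAction.exists_equivariant_equiv_of_stabilizer_eq
      (Ue (𝒢.graph.edgeOf b)) (by rw [hUi]; exact hℓ.ne_zero) hX hY (by rw [hcardP, hcardT])
    exact nonempty_iso_of_equivariant_equiv Fe f hf
  -- the object
  refine ⟨⟨Sv, Te, fun b v h => Classical.choice (hψ b v h)⟩, hπ₀, fun e => ?_⟩
  -- two components of `T_e`: the points over `0` and `1` of `Fin ℓ` are in different orbits
  let Fe := GaloisCategory.getFiberFunctor (𝒢.E e)
  obtain ⟨q⟩ : Nonempty (Aut Fe ⧸ Ue e) := ⟨QuotientGroup.mk 1⟩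
  let z₀ : Fe.obj (Te e) := (eT e).symm ⟨⟨0, by omega⟩, q⟩
  let z₁ : Fe.obj (Te e) := (eT e).symm ⟨⟨1, by omega⟩, q⟩
  refine exists_ne_π₀Obj_of_not_mem_orbit Fe z₀ z₁ ?_
  rintro ⟨σ, hσ⟩
  have h1 : eT e (σ • z₀) = eT e z₁ := by rw [← hσ]
  rw [heT] at h1
  simp only [z₀, z₁, Equiv.apply_symm_apply] at h1
  have h2 : ((⟨0, by omega⟩ : Fin ℓ)) = ⟨1, by omega⟩ := congrArg _root_.Sigma.fst h1
  exact absurd (congrArg Fin.val h2) Nat.zero_ne_one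

/-- **[SemiAnbd] Ex. 2.10 (3), first half: every closed edge of a semi-graph of anabelioids of surface
type is sub-coverticial.** [cite: MochizukiSemiAnbd2006, Ex. 2.10 p.31] -/
theorem IsOfSurfaceType.isSubCoverticial (hS : 𝒢.IsOfSurfaceType Sigma) {e : 𝒢.graph.Edge}
    (he : 𝒢.graph.IsClosedEdge e) : 𝒢.IsSubCoverticial e := by
  obtain ⟨A, hV, hE⟩ := hS.exists_bObj_connected_split
  obtain ⟨Q₁, Q₂, hQ⟩ := hE e
  exact A.isSubCoverticial_of_components hV he Q₁ Q₂ hQ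

/-- **[SemiAnbd] Ex. 2.10 (3), first half: a semi-graph of anabelioids of surface type is totally
sub-coverticial.** [cite: MochizukiSemiAnbd2006, Ex. 2.10 p.31] -/
theorem IsOfSurfaceType.isTotallySubCoverticial (hS : 𝒢.IsOfSurfaceType Sigma) :
    𝒢.IsTotallySubCoverticial :=
  ⟨fun _ he => hS.isSubCoverticial he⟩

/-! ### Universality, granted the stability of surface type under finite étale coverings -/

/-- Along a finite étale covering (print's sense), an edge over a closed edge is closed (the base
morphism is proper). [cite: MochizukiSemiAnbd2006, Def. 2.2(i) p.23] -/
theorem Hom.isClosedEdge_of_isFiniteEtaleCoveringGlobal {𝒢' : SemiGraphOfAnabelioids.{v₁, u₁, u}}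
    (φ : Hom 𝒢' 𝒢) (hφ : φ.IsFiniteEtaleCoveringGlobal) {e' : 𝒢'.graph.Edge}
    (he : 𝒢.graph.IsClosedEdge (φ.base.edgeMap e')) : 𝒢'.graph.IsClosedEdge e' := by
  obtain ⟨A, hloc, -⟩ := hφ
  have hprop := hloc.1 e'
  unfold SemiGraph.IsClosedEdge at he ⊢
  rw [← hprop]; exact he

/-- **[SemiAnbd] Ex. 2.10 (3): a semi-graph of anabelioids of surface type is totally UNIVERSALLY
sub-coverticial**, granted the classical fact `PuncturedSurfaceGroupFiniteIndexSubgroup` (finite-index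
subgroups of punctured surface groups; used only through the stability of surface type under finite
étale coverings, `IsOfSurfaceType.of_isFiniteEtaleCoveringGlobal`, abc-iut-w4-d089): every finite étale
covering of `𝒢` is again of surface type, hence totally sub-coverticial.
[cite: MochizukiSemiAnbd2006, Ex. 2.10 p.31] -/
theorem IsOfSurfaceType.isTotallyUniversallySubCoverticial_of
    (hA : PuncturedSurfaceGroupFiniteIndexSubgroup) (hS : 𝒢.IsOfSurfaceType Sigma) :
    𝒢.IsTotallyUniversallySubCoverticial := by
  refine ⟨fun e he => ⟨he, fun 𝒢'' φ hφ e'' he'' => ?_⟩⟩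
  have hS'' : 𝒢''.IsOfSurfaceType Sigma := IsOfSurfaceType.of_isFiniteEtaleCoveringGlobal hA hS φ hφ
  exact hS''.isSubCoverticial (φ.isClosedEdge_of_isFiniteEtaleCoveringGlobal hφ (he''.symm ▸ he))

/-- **[SemiAnbd] Ex. 2.10, conjunct (3), in the shape of `example_2_10`** (granted
`PuncturedSurfaceGroupFiniteIndexSubgroup`; the hypothesis `EveryEdgeAbuts` of `example_2_10` is not
needed for this conjunct). [cite: MochizukiSemiAnbd2006, Ex. 2.10 p.31] -/
theorem example_2_10_subCoverticial_of (hA : PuncturedSurfaceGroupFiniteIndexSubgroup) :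
    ∀ (𝒢 : SemiGraphOfAnabelioids.{v₁, u₁, u}) (Sigma : Set ℕ),
      𝒢.IsOfSurfaceType Sigma → 𝒢.IsTotallyUniversallySubCoverticial :=
  fun _ _ hS => hS.isTotallyUniversallySubCoverticial_of hA

end SemiGraphOfAnabelioids

end Literature.AnabelianGeometry.SemiGraphs
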